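import Literature.MathematicalPhysics.QuantumFieldTheory.Balaban1983to89.T4EMLTangentInjective

/-!
# Route `ReplicaVarianceTilt` — crux `HeightChiSqL` (stmt-QuantumFields-26133), toward the residual of `stub_acIntegrable`:
# the derivative `emlD` of the exp-mean-log fibre map is JOINTLY CONTINUOUS in the frozen holonomies and the variable
# (helper `--supports stmt-QuantumFields-26133`)

Width seat `ym-line-sfw-p2-w3` gen 21 (home cell `ym-idea-1`; R3 RECORD rung — no summit, no rung and no crux is proved here; the YM mass
gap is NOT proved by any of this).  Pure calculus over Mathlib and the tree's `T4EMLTangentInjective` (`Kmat h c M = exp(Σᵢ cᵢ log(hᵢ M*))·M`,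
its explicit strict derivative `emlD h c W`, `L²`-operator norm on `M_N(ℂ)`); every declaration is [folklore].
PURPOSE.  After `…HeightChiSqLHaarDominatedMatrix.haar_restrict_map_le_smul_of_matrix` the registered stub `stub_acIntegrable` of crux
`HeightChiSqL` is reduced (`…HeightChiSqLOfFibreLawBound.stubText_of_fibreLawBound`) to two statements about `Kmat`/`emlD` on the compact
guard `{(h, W) : hᵢ, W unitary, ‖hᵢ W* − 1‖ ≤ 1/3}`, both UNIFORM in `h`: (a) a tangent floor `c‖X‖ ≤ ‖emlD h c W (W X)‖` (`X` skew-Hermitian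
traceless), (b) a uniform injectivity radius.  Both are compactness arguments whose analytic input is the JOINT continuity of
`(h, W) ↦ emlD h c W` — proved here:
* `isOpen_emlDomain` — `{(h, W) | ∀ i, ‖hᵢ W* − 1‖ < 1}` is open;
* `analyticOnNhd_Kmat` — `(h, M) ↦ Kmat h c M` is jointly real-analytic there (`MatrixLog.analyticAt_mlog`, `NormedSpace.exp_analytic`);
* `emlD_eq_fderiv_comp_inr` — `emlD h c W` is the partial derivative in `W` of the joint map (uniqueness against
  `T4EMLTangentInjective.hasStrictFDerivAt_Kmat`);
* `continuousOn_emlD` — `(h, W) ↦ emlD h c W` is continuous on the domain (into `M_N(ℂ) →L[ℝ] M_N(ℂ)`); `continuousOn_emlD_apply_mul` —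
  `(h, W, X) ↦ emlD h c W (W X)` is continuous.
WHAT IS LEFT (not here): (a) the minimum of `‖emlD h c W (W X)‖` over the compact set `guard × {X ∈ 𝔰𝔲(2), ‖X‖ = 1}` is positive
(`emlD_tangent_injective` pointwise + this continuity); (b) the uniform injectivity radius (joint strict differentiability of the cone extension
+ compactness); then `…HaarDominatedMatrix` and `…OfFibreLawBound` close `stub_acIntegrable`.  No estimate of Bałaban's is used.
-/

noncomputable section

open NormedSpace Set Filter Topology Function

namespace Summit.QuantumFields.YangMills.Theorems.HeightChiSqLEmlDContinuous

open scoped Matrix.Norms.L2Operator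
open Literature.MathematicalPhysics.QuantumFieldTheory.Balaban1983to89.T4EMLTangentInjective (Kmat emlD hasStrictFDerivAt_Kmat)
open Literature.MathematicalPhysics.QuantumFieldTheory.Balaban1983to89.MatrixLog (mlog analyticAt_mlog)
open Literature.Analysis.SpecialFunctions

variable {m : Type*} [Fintype m] [DecidableEq m] {ι : Type*} [Fintype ι]

/-- The domain `{(h, W) | ∀ i, ‖hᵢ W* − 1‖ < 1}` of the exp-mean-log fibre map is open in `(ι → M_N(ℂ)) × M_N(ℂ)`. [folklore] -/
theorem isOpen_emlDomain :
    IsOpen {p : (ι → (Matrix m m ℂ)) × (Matrix m m ℂ) | ∀ i, ‖p.1 i * star p.2 - 1‖ < 1} := by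
  rw [Set.setOf_forall]
  refine isOpen_iInter_of_finite fun i => ?_
  have hc : Continuous fun p : (ι → (Matrix m m ℂ)) × (Matrix m m ℂ) => p.1 i * star p.2 :=
    ((continuous_apply i).comp continuous_fst).mul (continuous_star.comp continuous_snd)
  exact isOpen_lt (hc.sub continuous_const).norm continuous_const

/-- **THE EXP-MEAN-LOG FIBRE MAP IS JOINTLY REAL-ANALYTIC** in the frozen holonomies `h` and the variable `W` on the domain
`‖hᵢ W* − 1‖ < 1`: `(h, M) ↦ Kmat h c M = exp(Σᵢ cᵢ log(hᵢ M*)) · M`. [folklore] -/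
theorem analyticOnNhd_Kmat (c : ι → ℝ) :
    AnalyticOnNhd ℝ (fun p : (ι → (Matrix m m ℂ)) × (Matrix m m ℂ) => Kmat p.1 c p.2) {p | ∀ i, ‖p.1 i * star p.2 - 1‖ < 1} := by
  intro p hp
  -- the building blocks
  have hstar : AnalyticAt ℝ (fun q : (ι → (Matrix m m ℂ)) × (Matrix m m ℂ) => star q.2) p := by
    have e : (fun q : (ι → (Matrix m m ℂ)) × (Matrix m m ℂ) => star q.2) =
        fun q => ((starL' ℝ : (Matrix m m ℂ) ≃L[ℝ] (Matrix m m ℂ)) : (Matrix m m ℂ) →L[ℝ] (Matrix m m ℂ)) ((ContinuousLinearMap.snd ℝ (ι → (Matrix m m ℂ)) (Matrix m m ℂ)) q) := by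
      funext q; simp
    rw [e]
    exact (((starL' ℝ : (Matrix m m ℂ) ≃L[ℝ] (Matrix m m ℂ)) : (Matrix m m ℂ) →L[ℝ] (Matrix m m ℂ)).comp (ContinuousLinearMap.snd ℝ (ι → (Matrix m m ℂ)) (Matrix m m ℂ))).analyticAt p
  have hproj : ∀ i, AnalyticAt ℝ (fun q : (ι → (Matrix m m ℂ)) × (Matrix m m ℂ) => q.1 i) p := fun i =>
    ((ContinuousLinearMap.proj i).comp (ContinuousLinearMap.fst ℝ (ι → (Matrix m m ℂ)) (Matrix m m ℂ))).analyticAt p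
  have hA : ∀ i, AnalyticAt ℝ (fun q : (ι → (Matrix m m ℂ)) × (Matrix m m ℂ) => q.1 i * star q.2) p := fun i => (hproj i).mul hstar
  have hL : ∀ i, AnalyticAt ℝ (fun q : (ι → (Matrix m m ℂ)) × (Matrix m m ℂ) => mlog (q.1 i * star q.2)) p := fun i => by
    have hml : AnalyticAt ℝ (mlog : (Matrix m m ℂ) → (Matrix m m ℂ)) (p.1 i * star p.2) := (analyticAt_mlog (hp i)).restrictScalars
    exact AnalyticAt.comp (g := (mlog : (Matrix m m ℂ) → (Matrix m m ℂ))) (f := fun q : (ι → (Matrix m m ℂ)) × (Matrix m m ℂ) => q.1 i * star q.2) (x := p) hml (hA i)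
  have hY : AnalyticAt ℝ (fun q : (ι → (Matrix m m ℂ)) × (Matrix m m ℂ) => ∑ i, (c i : ℂ) • mlog (q.1 i * star q.2)) p :=
    Finset.analyticAt_fun_sum _ fun i _ => analyticAt_const.fun_smul (hL i)
  have hE : AnalyticAt ℝ (fun q : (ι → (Matrix m m ℂ)) × (Matrix m m ℂ) => exp (∑ i, (c i : ℂ) • mlog (q.1 i * star q.2))) p := by
    have hexp : AnalyticAt ℝ (fun Y : (Matrix m m ℂ) => exp Y) (∑ i, (c i : ℂ) • mlog (p.1 i * star p.2)) :=
      (NormedSpace.exp_analytic (𝕂 := ℂ) _).restrictScalars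
    exact AnalyticAt.comp (g := fun Y : (Matrix m m ℂ) => exp Y)
      (f := fun q : (ι → (Matrix m m ℂ)) × (Matrix m m ℂ) => ∑ i, (c i : ℂ) • mlog (q.1 i * star q.2)) (x := p) hexp hY
  exact hE.mul ((ContinuousLinearMap.snd ℝ (ι → (Matrix m m ℂ)) (Matrix m m ℂ)).analyticAt p)

variable [Nonempty m]

/-- **THE EXPLICIT DERIVATIVE `emlD h c W` IS THE PARTIAL DERIVATIVE IN `W` OF THE JOINT MAP**: on the domain,
`emlD h c W = (fderiv ℝ (h, W) ↦ Kmat h c W) ∘ inr`. [folklore] -/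
theorem emlD_eq_fderiv_comp_inr (c : ι → ℝ) {p : (ι → (Matrix m m ℂ)) × (Matrix m m ℂ)} (hp : ∀ i, ‖p.1 i * star p.2 - 1‖ < 1) :
    emlD p.1 c p.2 = (fderiv ℝ (fun q : (ι → (Matrix m m ℂ)) × (Matrix m m ℂ) => Kmat q.1 c q.2) p).comp
      (ContinuousLinearMap.inr ℝ (ι → (Matrix m m ℂ)) (Matrix m m ℂ)) := by
  have hΦ := analyticOnNhd_Kmat (m := m) c p hp
  have h1 : HasFDerivAt (fun q : (ι → (Matrix m m ℂ)) × (Matrix m m ℂ) => Kmat q.1 c q.2)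
      (fderiv ℝ (fun q : (ι → (Matrix m m ℂ)) × (Matrix m m ℂ) => Kmat q.1 c q.2) p) p := hΦ.differentiableAt.hasFDerivAt
  have h2 : HasFDerivAt (fun W : (Matrix m m ℂ) => Kmat p.1 c W)
      ((fderiv ℝ (fun q : (ι → (Matrix m m ℂ)) × (Matrix m m ℂ) => Kmat q.1 c q.2) p).comp (ContinuousLinearMap.inr ℝ (ι → (Matrix m m ℂ)) (Matrix m m ℂ))) p.2 := by
    have h := h1.comp p.2 (hasFDerivAt_prodMk_right (𝕜 := ℝ) p.1 p.2)
    exact h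
  exact (hasStrictFDerivAt_Kmat p.1 c hp).hasFDerivAt.unique h2

/-- **JOINT CONTINUITY OF THE DERIVATIVE**: `(h, W) ↦ emlD h c W` is continuous on `{‖hᵢ W* − 1‖ < 1}` (as a map into `M_N(ℂ) →L[ℝ] M_N(ℂ)`).
This is the analytic input of the compactness arguments for the uniform tangent floor and the uniform injectivity radius of the guarded
exp-mean-log fibre laws. [folklore] -/
theorem continuousOn_emlD (c : ι → ℝ) :
    ContinuousOn (fun p : (ι → (Matrix m m ℂ)) × (Matrix m m ℂ) => emlD p.1 c p.2) {p | ∀ i, ‖p.1 i * star p.2 - 1‖ < 1} := by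
  have hG := isOpen_emlDomain (m := m) (ι := ι)
  have hC1 : ContDiffOn ℝ 1 (fun q : (ι → (Matrix m m ℂ)) × (Matrix m m ℂ) => Kmat q.1 c q.2) {p | ∀ i, ‖p.1 i * star p.2 - 1‖ < 1} :=
    (analyticOnNhd_Kmat (m := m) c).contDiffOn hG.uniqueDiffOn
  have hcont : ContinuousOn (fun q : (ι → (Matrix m m ℂ)) × (Matrix m m ℂ) => fderiv ℝ (fun q : (ι → (Matrix m m ℂ)) × (Matrix m m ℂ) => Kmat q.1 c q.2) q)
      {p | ∀ i, ‖p.1 i * star p.2 - 1‖ < 1} := hC1.continuousOn_fderiv_of_isOpen hG le_rfl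
  have hcomp : ContinuousOn (fun q : (ι → (Matrix m m ℂ)) × (Matrix m m ℂ) =>
      (fderiv ℝ (fun q : (ι → (Matrix m m ℂ)) × (Matrix m m ℂ) => Kmat q.1 c q.2) q).comp (ContinuousLinearMap.inr ℝ (ι → (Matrix m m ℂ)) (Matrix m m ℂ)))
      {p | ∀ i, ‖p.1 i * star p.2 - 1‖ < 1} := hcont.clm_comp continuousOn_const
  exact hcomp.congr fun p hp => emlD_eq_fderiv_comp_inr c hp

/-- **CONTINUITY OF THE TANGENT ACTION**: `(h, W, X) ↦ emlD h c W (W X)` is continuous on `{‖hᵢ W* − 1‖ < 1} × M_N(ℂ)`. [folklore] -/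
theorem continuousOn_emlD_apply_mul (c : ι → ℝ) :
    ContinuousOn (fun p : ((ι → (Matrix m m ℂ)) × (Matrix m m ℂ)) × (Matrix m m ℂ) => emlD p.1.1 c p.1.2 (p.1.2 * p.2))
      {p | ∀ i, ‖p.1.1 i * star p.1.2 - 1‖ < 1} := by
  have h1 : ContinuousOn (fun p : ((ι → (Matrix m m ℂ)) × (Matrix m m ℂ)) × (Matrix m m ℂ) => emlD p.1.1 c p.1.2) {p | ∀ i, ‖p.1.1 i * star p.1.2 - 1‖ < 1} :=
    (continuousOn_emlD (m := m) c).comp continuous_fst.continuousOn fun p hp => hp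
  have h2 : Continuous fun p : ((ι → (Matrix m m ℂ)) × (Matrix m m ℂ)) × (Matrix m m ℂ) => p.1.2 * p.2 :=
    (continuous_snd.comp continuous_fst).mul continuous_snd
  exact h1.clm_apply h2.continuousOn

end Summit.QuantumFields.YangMills.Theorems.HeightChiSqLEmlDContinuous

end
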